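import Mathlib
import Summits.Ventures.PercRepro2.TypedTwoEdgesAtO

/-!
# An `a₃`-edge at a mark `o` of typed degree two is worth a factor `2` (blind cell PercRepro2,
night-3 g16, 2026-08-27; NIGHT3-CERT.md §25.6)

For the kernel `K₃` of (HCOV): if `o` carries exactly two typed edges `e = {o, u}` and
`f = {o, a₃}`, both of type `1`, every other edge at `o` being pinned closed and untyped, then

  `N_τ = 2 · N_τ(F ∖ f, f pinned closed)`   (`typedCount_o_a3_edge`)

— the double-attachment class of the deletion–contraction identity `typedCount_two_edges_at_o`
VANISHES POINTWISE (in the copy carrying both edges `o ~ a₃`, so `σ_o = σ₃`, `u_o = u₃` there: the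
`o`-terms of that copy cancel in pairs exactly as in the coincidence `o = a₃`, and the other copies
carry no `o`-factor: `KB_oa3_x/y/z`), and the deletion of `e` (`o` pendant at `a₃`) vanishes by
the same mechanism.  With the pendant rule (`typedCount_pendant_o'`) the remaining count is the
instance with `o` contracted into `u`: `N(G₀ + o ~ {a₃, u}) = 2 · N(G₀, o := u)`.  This upgrades
night-3 g14's positivity rule «`o` between `a₃` and `b`» (§23.8) to an exact reduction, for every
second neighbour `u`.  Own work; standard axioms.
-/

namespace Summit.Ventures.PercRepro2

namespace CovForm

namespace TypedRed

open OneTyped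

/-! ## The kernel with `o ~ a₃` in the one copy that carries `o` -/

section Kernel

/-- `o ~ a₃` in copy `1`, `o` isolated in copies `2`, `3`: the kernel vanishes. -/
lemma KB_oa3_x (x y z : St) (hx : x.Lo = x.L3 ∧ x.Ho = x.H3) :
    KB x (killO y) (killO z) = 0 := by
  have h := KB_killO true false false x y z
  simp only [cond_true, cond_false, if_true, Bool.false_eq_true, if_false, add_zero] at h
  rw [h]
  obtain ⟨q, lo, ho, lb, hb, l3, h3⟩ := x
  simp only [St.Lo, St.Ho, St.L3, St.H3] at hx
  obtain ⟨rfl, rfl⟩ := hx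
  cases q <;> cases lo <;> cases ho <;> cases lb <;> cases hb <;>
    simp [KOx, pdB, uB, St.q', St.Lo, St.Ho, St.Lb, St.Hb, St.L3, St.H3]

/-- `o ~ a₃` in copy `2`, `o` isolated in copies `1`, `3`: the kernel vanishes. -/
lemma KB_oa3_y (x y z : St) (hy : y.Lo = y.L3 ∧ y.Ho = y.H3) :
    KB (killO x) y (killO z) = 0 := by
  have h := KB_killO false true false x y z
  simp only [cond_true, cond_false, if_true, Bool.false_eq_true, if_false, add_zero, zero_add] at h
  rw [h]
  obtain ⟨q, lo, ho, lb, hb, l3, h3⟩ := y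
  simp only [St.Lo, St.Ho, St.L3, St.H3] at hy
  obtain ⟨rfl, rfl⟩ := hy
  cases q <;> cases lo <;> cases ho <;> cases lb <;> cases hb <;>
    simp [KOy, pdB, uB, St.q', St.Lo, St.Ho, St.Lb, St.Hb, St.L3, St.H3]

/-- `o ~ a₃` in copy `3`, `o` isolated in copies `1`, `2`: the kernel vanishes. -/
lemma KB_oa3_z (x y z : St) (hz : z.Lo = z.L3 ∧ z.Ho = z.H3) :
    KB (killO x) (killO y) z = 0 := by
  have h := KB_killO false false true x y z
  simp only [cond_true, cond_false, if_true, Bool.false_eq_true, if_false, zero_add] at h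
  rw [h]
  obtain ⟨q, lo, ho, lb, hb, l3, h3⟩ := z
  simp only [St.Lo, St.Ho, St.L3, St.H3] at hz
  obtain ⟨rfl, rfl⟩ := hz
  cases q <;> cases lo <;> cases ho <;> cases lb <;> cases hb <;>
    simp [KOz, pdB, qB, uB, sigB, St.q', St.Lo, St.Ho, St.Lb, St.Hb, St.L3, St.H3]

end Kernel

/-! ## The state of a copy in which `o ~ a₃` -/

section States

open Classical

variable {V : Type*} {E : Type*} [DecidableEq E]

variable (ends : E → Sym2 V) (o a₁ a₂ a₃ b : V)

omit [DecidableEq E] in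
/-- If `o ↔ a₃` in `ω`, the state carries the same side data for `o` and `a₃`. -/
lemma st_oa3_of_conn {ω : Config E} (h : Conn ends ω o a₃) :
    (st ends o a₁ a₂ a₃ b ω).Lo = (st ends o a₁ a₂ a₃ b ω).L3 ∧
      (st ends o a₁ a₂ a₃ b ω).Ho = (st ends o a₁ a₂ a₃ b ω).H3 := by
  unfold st
  simp only [St.Lo, St.Ho, St.L3, St.H3]
  exact ⟨decide_eq_decide.mpr ⟨fun h1 => conn_trans h1 h, fun h1 => conn_trans h1 (conn_symm h)⟩,
    decide_eq_decide.mpr ⟨fun h1 => conn_trans h1 h, fun h1 => conn_trans h1 (conn_symm h)⟩⟩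

/-- With `f = {o, a₃}` open, `o ↔ a₃`. -/
lemma conn_oa3_of_open {f : E} (hf : ends f = s(o, a₃)) (ω : Config E) :
    Conn ends (Function.update ω f true) o a₃ :=
  conn_of_openAdj ⟨f, Function.update_self f true ω, hf⟩

end States

/-! ## The reduction -/

section Main

open Classical

variable {V : Type*} {E : Type*} [Fintype E] [DecidableEq E] {R : Type*} [Field R]

variable (ends : E → Sym2 V) (o a₁ a₂ a₃ b : V)

/-- The typed count of the zero kernel. -/
lemma typedCount_zero_kernel (F : Finset E) (z : Config E) (τ : E → ℕ) :
    typedCount F z τ (fun _ _ _ => (0 : R)) = 0 := by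
  unfold typedCount
  simp

/-- **An `a₃`-edge at a mark `o` of typed degree two**: with `e = {o, u}`, `f = {o, a₃}` ∈ `F` of
type `1` and every other edge at `o` pinned closed and untyped, `N_τ = 2 · N_τ(F ∖ f)`. -/
theorem typedCount_o_a3_edge {e f : E} {u : V} (he : ends e = s(o, u))
    (hf : ends f = s(o, a₃)) (hou : o ≠ u) (hef : e ≠ f) (ho1 : o ≠ a₁) (ho2 : o ≠ a₂)
    (ho3 : o ≠ a₃) (hob : o ≠ b) (F : Finset E) (heF : e ∈ F) (hfF : f ∈ F) (z : Config E)
    (τ : E → ℕ) (hτe : τ e = 1) (hτf : τ f = 1)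
    (hcl : ∀ e', e' ≠ e → e' ≠ f → o ∈ ends e' → e' ∉ F ∧ z e' = false) :
    typedCount F z τ (K3 ends o a₁ a₂ a₃ b : Config E → Config E → Config E → R) =
      2 * typedCount (F.erase f) (Function.update z f false) τ (K3 ends o a₁ a₂ a₃ b) := by
  rw [typedCount_two_edges_at_o ends o a₁ a₂ a₃ b he hf hou ho3 hef ho1 ho2 ho3 hob F heF hfF z τ
    hτe hτf hcl]
  -- the copy carrying `f` has `o ~ a₃`
  have hfx : ∀ (x : Config E) (p : Bool), (st ends o a₁ a₂ a₃ b (Function.update (Function.update x f true) e p)).Lo =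
      (st ends o a₁ a₂ a₃ b (Function.update (Function.update x f true) e p)).L3 ∧
      (st ends o a₁ a₂ a₃ b (Function.update (Function.update x f true) e p)).Ho =
      (st ends o a₁ a₂ a₃ b (Function.update (Function.update x f true) e p)).H3 := by
    intro x p
    apply st_oa3_of_conn
    rw [Function.update_comm hef.symm]
    exact conn_oa3_of_open ends o a₃ hf _
  -- (i) the double class vanishes pointwise
  have hD : doubleClass F z τ e f (K3 ends o a₁ a₂ a₃ b : Config E → Config E → Config E → R) = 0 := by
    unfold doubleClass term
    have h1 : ∀ (x y w : Config E),
        (∀ e', e' ∉ (F.erase e).erase f →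
          x e' = Function.update (Function.update z e false) f false e' ∧
          y e' = Function.update (Function.update z e false) f false e' ∧
          w e' = Function.update (Function.update z e false) f false e') →
        (K3 ends o a₁ a₂ a₃ b (upd2 x e f true true) (upd2 y e f false false)
          (upd2 w e f false false) : R) = 0 := by
      intro x y w hxyw
      have hy := (support_closed ends o F z hcl hef y fun e' he' => (hxyw e' he').2.1).1
      have hw := (support_closed ends o F z hcl hef w fun e' he' => (hxyw e' he').2.2).1
      simp only [upd2, K3_eq_KB]
      rw [st_two_closed_e ends o a₁ a₂ a₃ b he hou hef ho1 ho2 ho3 hob hy,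
        st_two_closed_e ends o a₁ a₂ a₃ b he hou hef ho1 ho2 ho3 hob hw, KB_oa3_x _ _ _ (hfx x true)]
      simp
    have h2 : ∀ (x y w : Config E),
        (∀ e', e' ∉ (F.erase e).erase f →
          x e' = Function.update (Function.update z e false) f false e' ∧
          y e' = Function.update (Function.update z e false) f false e' ∧
          w e' = Function.update (Function.update z e false) f false e') →
        (K3 ends o a₁ a₂ a₃ b (upd2 x e f false false) (upd2 y e f true true)
          (upd2 w e f false false) : R) = 0 := by
      intro x y w hxyw
      have hx := (support_closed ends o F z hcl hef x fun e' he' => (hxyw e' he').1).1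
      have hw := (support_closed ends o F z hcl hef w fun e' he' => (hxyw e' he').2.2).1
      simp only [upd2, K3_eq_KB]
      rw [st_two_closed_e ends o a₁ a₂ a₃ b he hou hef ho1 ho2 ho3 hob hx,
        st_two_closed_e ends o a₁ a₂ a₃ b he hou hef ho1 ho2 ho3 hob hw, KB_oa3_y _ _ _ (hfx y true)]
      simp
    have h3 : ∀ (x y w : Config E),
        (∀ e', e' ∉ (F.erase e).erase f →
          x e' = Function.update (Function.update z e false) f false e' ∧
          y e' = Function.update (Function.update z e false) f false e' ∧
          w e' = Function.update (Function.update z e false) f false e') →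
        (K3 ends o a₁ a₂ a₃ b (upd2 x e f false false) (upd2 y e f false false)
          (upd2 w e f true true) : R) = 0 := by
      intro x y w hxyw
      have hx := (support_closed ends o F z hcl hef x fun e' he' => (hxyw e' he').1).1
      have hy := (support_closed ends o F z hcl hef y fun e' he' => (hxyw e' he').2.1).1
      simp only [upd2, K3_eq_KB]
      rw [st_two_closed_e ends o a₁ a₂ a₃ b he hou hef ho1 ho2 ho3 hob hx,
        st_two_closed_e ends o a₁ a₂ a₃ b he hou hef ho1 ho2 ho3 hob hy, KB_oa3_z _ _ _ (hfx w true)]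
      simp
    rw [typedCount_congr_K_on _ _ _ (fun x y w hxyw _ => h1 x y w hxyw),
      typedCount_congr_K_on _ _ _ (fun x y w hxyw _ => h2 x y w hxyw),
      typedCount_congr_K_on _ _ _ (fun x y w hxyw _ => h3 x y w hxyw), typedCount_zero_kernel]
    ring
  -- (ii) with `e` deleted, `o` is pendant at `a₃`: the count vanishes
  have hE : typedCount (F.erase e) (Function.update z e false) τ
      (K3 ends o a₁ a₂ a₃ b : Config E → Config E → Config E → R) = 0 := by
    have hfe : f ∈ F.erase e := Finset.mem_erase.2 ⟨hef.symm, hfF⟩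
    rw [typedCount_split (F.erase e) f hfe, hτf, sum_bool3_one]
    -- on the support every edge at `o` other than `f` is closed
    have hcl' : ∀ (x : Config E),
        (∀ e', e' ∉ (F.erase e).erase f →
          x e' = Function.update (Function.update z e false) f false e') →
        ∀ e', e' ≠ f → o ∈ ends e' → x e' = false := by
      intro x hx e' hf' ho
      by_cases he' : e' = e
      · subst he'
        rw [hx e' (fun h => Finset.notMem_erase e' F (Finset.mem_of_mem_erase h)),
          Function.update_of_ne hf', Function.update_self]
      · exact (support_closed ends o F z hcl hef x hx).1 e' he' hf' ho
    have hst : ∀ (x : Config E), (∀ e', e' ≠ f → o ∈ ends e' → x e' = false) →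
        st ends o a₁ a₂ a₃ b (Function.update x f false) =
          killO (st ends o a₁ a₂ a₃ b (Function.update x f true)) :=
      fun x hx => st_update_closed_o ends o a₁ a₂ a₃ b hf ho3 ho1 ho2 ho3 hob hx
    have hoa : ∀ (x : Config E), (st ends o a₁ a₂ a₃ b (Function.update x f true)).Lo =
        (st ends o a₁ a₂ a₃ b (Function.update x f true)).L3 ∧
        (st ends o a₁ a₂ a₃ b (Function.update x f true)).Ho =
          (st ends o a₁ a₂ a₃ b (Function.update x f true)).H3 :=
      fun x => st_oa3_of_conn ends o a₁ a₂ a₃ b (conn_oa3_of_open ends o a₃ hf x)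
    have k1 : typedCount ((F.erase e).erase f) (Function.update (Function.update z e false) f false) τ
        (fun x y w => (K3 ends o a₁ a₂ a₃ b (Function.update x f true) (Function.update y f false)
          (Function.update w f false) : R)) = 0 := by
      rw [← typedCount_zero_kernel ((F.erase e).erase f) (Function.update (Function.update z e false) f false) τ]
      refine typedCount_congr_K_on _ _ _ fun x y w hxyw _ => ?_
      rw [K3_eq_KB, hst y (hcl' y fun e' he' => (hxyw e' he').2.1),
        hst w (hcl' w fun e' he' => (hxyw e' he').2.2), KB_oa3_x _ _ _ (hoa x)]
      simp
    have k2 : typedCount ((F.erase e).erase f) (Function.update (Function.update z e false) f false) τ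
        (fun x y w => (K3 ends o a₁ a₂ a₃ b (Function.update x f false) (Function.update y f true)
          (Function.update w f false) : R)) = 0 := by
      rw [← typedCount_zero_kernel ((F.erase e).erase f) (Function.update (Function.update z e false) f false) τ]
      refine typedCount_congr_K_on _ _ _ fun x y w hxyw _ => ?_
      rw [K3_eq_KB, hst x (hcl' x fun e' he' => (hxyw e' he').1),
        hst w (hcl' w fun e' he' => (hxyw e' he').2.2), KB_oa3_y _ _ _ (hoa y)]
      simp
    have k3 : typedCount ((F.erase e).erase f) (Function.update (Function.update z e false) f false) τ
        (fun x y w => (K3 ends o a₁ a₂ a₃ b (Function.update x f false) (Function.update y f false)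
          (Function.update w f true) : R)) = 0 := by
      rw [← typedCount_zero_kernel ((F.erase e).erase f) (Function.update (Function.update z e false) f false) τ]
      refine typedCount_congr_K_on _ _ _ fun x y w hxyw _ => ?_
      rw [K3_eq_KB, hst x (hcl' x fun e' he' => (hxyw e' he').1),
        hst y (hcl' y fun e' he' => (hxyw e' he').2.1), KB_oa3_z _ _ _ (hoa w)]
      simp
    rw [k1, k2, k3]
    ring
  rw [hD, hE]
  ring

end Main

end TypedRed

end CovForm

end Summit.Ventures.PercRepro2
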